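import Summits.QuantumFields.QCD.Theses.PauliWegnerSea

/-!
# Route `PauliWegnerSea`, item `SingleLinkLogFlatness` (stmt-QuantumFields-11516) — the Wilson
determinant along a one-link curve is a trigonometric polynomial of degree `≤ 24`

Degree-tracked version of the closure computation of
`PauliWegnerSeaGluonicCompletionDetAlongLinkCurve.lean`: the class
`T(N) = {θ ↦ p(e^{iθ}) e^{-iNθ} : deg p ≤ 2N}` of trigonometric polynomials of degree `≤ N` (written
inline in every statement) contains the constants, is monotone in `N`, closed under sums (same `N`),
products (`T(N₁) T(N₂) ⊆ T(N₁+N₂)`), `if-then-else` with a `θ`-independent condition and complex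
conjugation; the determinant of a matrix whose row `i` has entries in `T(d i)` lies in `T(∑ i, d i)`
(Leibniz).  For `U` with the link `e` replaced by `κ(θ)`, `κ` a curve in `SU(3)` with entries in `T(1)`,
row `p = (x, a, α)` of the `r = 1` Wilson–Dirac matrix has entries in `T(d p)` with
`d p = [x = e.1] + [x = e.1 + ê.2]`, and `∑ p, d p = 12 + 12 = 24`, uniformly in the volume.
-/

noncomputable section

namespace Summit.QuantumFields.QCD.Theorems.SingleLinkLogFlatness

open scoped BigOperators
open Complex Polynomial
open Literature.MathematicalPhysics.QuantumFieldTheory Literature.MathematicalPhysics.QuantumLattice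
  Literature.Probability.LatticeModels

/-! ### The degree-tracked class of trigonometric polynomials -/

/-- `(e^{iθ})^k · e^{-iNθ} = e^{i(k-N)θ}`-type bookkeeping: `(e^{iθ})^a e^{-i b θ} = (e^{iθ})^c e^{-i d θ}`
whenever `a + d = c + b`. [folklore] -/
theorem exp_pow_mul_exp_neg_eq (θ : ℝ) {a b c d : ℕ} (h : a + d = c + b) :
    cexp (θ * I) ^ a * cexp (-(b * θ * I)) = cexp (θ * I) ^ c * cexp (-(d * θ * I)) := by
  rw [← Complex.exp_nat_mul, ← Complex.exp_nat_mul, ← Complex.exp_add, ← Complex.exp_add]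
  congr 1
  have h' : (a : ℂ) + d = c + b := by exact_mod_cast h
  linear_combination (θ * I) * h'

/-- Constants lie in `T(N)` (`p = a X^N`). [folklore] -/
theorem tp_const (N : ℕ) (a : ℂ) :
    ∃ p : ℂ[X], p.natDegree ≤ 2 * N ∧ ∀ θ : ℝ,
      (fun _ : ℝ => a) θ = p.eval (cexp (θ * I)) * cexp (-(N * θ * I)) := by
  refine ⟨C a * X ^ N, (natDegree_C_mul_X_pow_le a N).trans (by omega), fun θ => ?_⟩
  have h1 : cexp (θ * I) ^ N * cexp (-(N * θ * I)) = 1 := by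
    rw [← Complex.exp_nat_mul, ← Complex.exp_add]
    convert Complex.exp_zero using 2
    ring
  change a = (C a * X ^ N).eval (cexp (θ * I)) * cexp (-(N * θ * I))
  rw [eval_mul, eval_C, eval_pow, eval_X, mul_assoc, h1, mul_one]

/-- `T(N₁) ⊆ T(N₂)` for `N₁ ≤ N₂` (`p ↦ p X^{N₂-N₁}`). [folklore] -/
theorem tp_mono {N₁ N₂ : ℕ} (hN : N₁ ≤ N₂) {f : ℝ → ℂ}
    (hf : ∃ p : ℂ[X], p.natDegree ≤ 2 * N₁ ∧ ∀ θ : ℝ,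
      f θ = p.eval (cexp (θ * I)) * cexp (-(N₁ * θ * I))) :
    ∃ p : ℂ[X], p.natDegree ≤ 2 * N₂ ∧ ∀ θ : ℝ,
      f θ = p.eval (cexp (θ * I)) * cexp (-(N₂ * θ * I)) := by
  obtain ⟨p, hp, hf⟩ := hf
  refine ⟨p * X ^ (N₂ - N₁), natDegree_mul_le.trans ?_, fun θ => ?_⟩
  · rw [natDegree_X_pow]; omega
  · have key := exp_pow_mul_exp_neg_eq θ (a := N₂ - N₁) (b := N₂) (c := 0) (d := N₁) (by omega)
    rw [pow_zero, one_mul] at key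
    rw [hf, eval_mul, eval_pow, eval_X, ← key]
    ring

/-- `T(N)` is closed under addition. [folklore] -/
theorem tp_add {N : ℕ} {f g : ℝ → ℂ}
    (hf : ∃ p : ℂ[X], p.natDegree ≤ 2 * N ∧ ∀ θ : ℝ,
      f θ = p.eval (cexp (θ * I)) * cexp (-(N * θ * I)))
    (hg : ∃ p : ℂ[X], p.natDegree ≤ 2 * N ∧ ∀ θ : ℝ,
      g θ = p.eval (cexp (θ * I)) * cexp (-(N * θ * I))) :
    ∃ p : ℂ[X], p.natDegree ≤ 2 * N ∧ ∀ θ : ℝ,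
      f θ + g θ = p.eval (cexp (θ * I)) * cexp (-(N * θ * I)) := by
  obtain ⟨p₁, hp₁, hf⟩ := hf
  obtain ⟨p₂, hp₂, hg⟩ := hg
  exact ⟨p₁ + p₂, (natDegree_add_le _ _).trans (max_le hp₁ hp₂), fun θ => by
    rw [hf, hg, eval_add]; ring⟩

/-- `T(N)` is closed under left multiplication by constants. [folklore] -/
theorem tp_const_mul {N : ℕ} (a : ℂ) {f : ℝ → ℂ}
    (hf : ∃ p : ℂ[X], p.natDegree ≤ 2 * N ∧ ∀ θ : ℝ,
      f θ = p.eval (cexp (θ * I)) * cexp (-(N * θ * I))) :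
    ∃ p : ℂ[X], p.natDegree ≤ 2 * N ∧ ∀ θ : ℝ,
      a * f θ = p.eval (cexp (θ * I)) * cexp (-(N * θ * I)) := by
  obtain ⟨p, hp, hf⟩ := hf
  exact ⟨C a * p, natDegree_C_mul_le a p |>.trans hp, fun θ => by rw [hf, eval_mul, eval_C]; ring⟩

/-- `T(N)` is closed under right multiplication by constants. [folklore] -/
theorem tp_mul_const {N : ℕ} (a : ℂ) {f : ℝ → ℂ}
    (hf : ∃ p : ℂ[X], p.natDegree ≤ 2 * N ∧ ∀ θ : ℝ,
      f θ = p.eval (cexp (θ * I)) * cexp (-(N * θ * I))) :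
    ∃ p : ℂ[X], p.natDegree ≤ 2 * N ∧ ∀ θ : ℝ,
      f θ * a = p.eval (cexp (θ * I)) * cexp (-(N * θ * I)) := by
  obtain ⟨p, hp, h⟩ := tp_const_mul a hf
  exact ⟨p, hp, fun θ => by rw [mul_comm]; exact h θ⟩

/-- `T(N)` is closed under subtraction. [folklore] -/
theorem tp_sub {N : ℕ} {f g : ℝ → ℂ}
    (hf : ∃ p : ℂ[X], p.natDegree ≤ 2 * N ∧ ∀ θ : ℝ,
      f θ = p.eval (cexp (θ * I)) * cexp (-(N * θ * I)))
    (hg : ∃ p : ℂ[X], p.natDegree ≤ 2 * N ∧ ∀ θ : ℝ,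
      g θ = p.eval (cexp (θ * I)) * cexp (-(N * θ * I))) :
    ∃ p : ℂ[X], p.natDegree ≤ 2 * N ∧ ∀ θ : ℝ,
      f θ - g θ = p.eval (cexp (θ * I)) * cexp (-(N * θ * I)) := by
  obtain ⟨p, hp, h⟩ := tp_add hf (tp_const_mul (-1) hg)
  exact ⟨p, hp, fun θ => by rw [sub_eq_add_neg, ← neg_one_mul]; exact h θ⟩

/-- `T(N₁) · T(N₂) ⊆ T(N₁ + N₂)`. [folklore] -/
theorem tp_mul {N₁ N₂ : ℕ} {f g : ℝ → ℂ}
    (hf : ∃ p : ℂ[X], p.natDegree ≤ 2 * N₁ ∧ ∀ θ : ℝ,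
      f θ = p.eval (cexp (θ * I)) * cexp (-(N₁ * θ * I)))
    (hg : ∃ p : ℂ[X], p.natDegree ≤ 2 * N₂ ∧ ∀ θ : ℝ,
      g θ = p.eval (cexp (θ * I)) * cexp (-(N₂ * θ * I))) :
    ∃ p : ℂ[X], p.natDegree ≤ 2 * (N₁ + N₂) ∧ ∀ θ : ℝ,
      f θ * g θ = p.eval (cexp (θ * I)) * cexp (-((N₁ + N₂ : ℕ) * θ * I)) := by
  obtain ⟨p₁, hp₁, hf⟩ := hf
  obtain ⟨p₂, hp₂, hg⟩ := hg
  refine ⟨p₁ * p₂, natDegree_mul_le.trans (by omega), fun θ => ?_⟩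
  have he : cexp (-((N₁ + N₂ : ℕ) * θ * I)) = cexp (-(N₁ * θ * I)) * cexp (-(N₂ * θ * I)) := by
    rw [← Complex.exp_add]; congr 1; push_cast; ring
  rw [hf, hg, eval_mul, he]; ring

/-- `T(N)` is closed under `if P then · else ·` for a `θ`-independent `P`. [folklore] -/
theorem tp_ite {N : ℕ} (P : Prop) [Decidable P] {f g : ℝ → ℂ}
    (hf : ∃ p : ℂ[X], p.natDegree ≤ 2 * N ∧ ∀ θ : ℝ,
      f θ = p.eval (cexp (θ * I)) * cexp (-(N * θ * I)))
    (hg : ∃ p : ℂ[X], p.natDegree ≤ 2 * N ∧ ∀ θ : ℝ,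
      g θ = p.eval (cexp (θ * I)) * cexp (-(N * θ * I))) :
    ∃ p : ℂ[X], p.natDegree ≤ 2 * N ∧ ∀ θ : ℝ,
      (if P then f θ else g θ) = p.eval (cexp (θ * I)) * cexp (-(N * θ * I)) := by
  by_cases h : P
  · simp only [h, ↓reduceIte]; exact hf
  · simp only [h, ↓reduceIte]; exact hg

/-- `T(N)` is closed under finite sums. [folklore] -/
theorem tp_sum {N : ℕ} {ι : Type*} (s : Finset ι) (f : ι → ℝ → ℂ)
    (hf : ∀ i ∈ s, ∃ p : ℂ[X], p.natDegree ≤ 2 * N ∧ ∀ θ : ℝ,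
      f i θ = p.eval (cexp (θ * I)) * cexp (-(N * θ * I))) :
    ∃ p : ℂ[X], p.natDegree ≤ 2 * N ∧ ∀ θ : ℝ,
      ∑ i ∈ s, f i θ = p.eval (cexp (θ * I)) * cexp (-(N * θ * I)) := by
  classical
  induction s using Finset.induction_on with
  | empty =>
    obtain ⟨p, hp, h⟩ := tp_const N 0
    exact ⟨p, hp, fun θ => by rw [Finset.sum_empty]; exact h θ⟩
  | @insert a s ha ih =>
    obtain ⟨p, hp, h⟩ := tp_add (hf a (Finset.mem_insert_self a s))
      (ih fun i hi => hf i (Finset.mem_insert_of_mem hi))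
    exact ⟨p, hp, fun θ => by rw [Finset.sum_insert ha]; exact h θ⟩

/-- Finite products: `∏ i ∈ s, T(d i) ⊆ T(∑ i ∈ s, d i)`. [folklore] -/
theorem tp_prod {ι : Type*} (s : Finset ι) (d : ι → ℕ) (f : ι → ℝ → ℂ)
    (hf : ∀ i ∈ s, ∃ p : ℂ[X], p.natDegree ≤ 2 * d i ∧ ∀ θ : ℝ,
      f i θ = p.eval (cexp (θ * I)) * cexp (-(d i * θ * I))) :
    ∃ p : ℂ[X], p.natDegree ≤ 2 * (∑ i ∈ s, d i) ∧ ∀ θ : ℝ,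
      ∏ i ∈ s, f i θ = p.eval (cexp (θ * I)) * cexp (-((∑ i ∈ s, d i : ℕ) * θ * I)) := by
  classical
  induction s using Finset.induction_on with
  | empty =>
    obtain ⟨p, hp, h⟩ := tp_const 0 1
    refine ⟨p, by simpa using hp, fun θ => ?_⟩
    rw [Finset.prod_empty, Finset.sum_empty]
    simpa using h θ
  | @insert a s ha ih =>
    obtain ⟨p, hp, h⟩ := tp_mul (hf a (Finset.mem_insert_self a s))
      (ih fun i hi => hf i (Finset.mem_insert_of_mem hi))
    refine ⟨p, by rw [Finset.sum_insert ha]; exact hp, fun θ => ?_⟩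
    rw [Finset.prod_insert ha, Finset.sum_insert ha]
    exact h θ

/-- `T(N)` is closed under complex conjugation: if `f θ = p(e^{iθ}) e^{-iNθ}` with `deg p ≤ 2N`,
`p = ∑_{k ≤ 2N} a_k X^k`, then `conj (f θ) = ∑_k conj(a_k) e^{-ikθ} e^{iNθ} = q(e^{iθ}) e^{-iNθ}` with
`q = ∑_{k ≤ 2N} conj(a_k) X^{2N-k}`. [folklore] -/
theorem tp_star {N : ℕ} {f : ℝ → ℂ}
    (hf : ∃ p : ℂ[X], p.natDegree ≤ 2 * N ∧ ∀ θ : ℝ,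
      f θ = p.eval (cexp (θ * I)) * cexp (-(N * θ * I))) :
    ∃ p : ℂ[X], p.natDegree ≤ 2 * N ∧ ∀ θ : ℝ,
      star (f θ) = p.eval (cexp (θ * I)) * cexp (-(N * θ * I)) := by
  obtain ⟨p, hp, hf⟩ := hf
  refine ⟨∑ k ∈ Finset.range (2 * N + 1), C (star (p.coeff k)) * X ^ (2 * N - k), ?_, fun θ => ?_⟩
  · refine (natDegree_sum_le _ _).trans (Finset.sup_le fun k _ => ?_)
    exact (natDegree_C_mul_X_pow_le _ _).trans (by simp)
  have hz : star (cexp (θ * I)) = cexp (-(θ * I)) := by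
    rw [← starRingEnd_apply, ← Complex.exp_conj, map_mul, Complex.conj_ofReal, Complex.conj_I]
    congr 1
    ring
  have hE : star (cexp (-(N * θ * I))) = cexp (N * θ * I) := by
    rw [← starRingEnd_apply, ← Complex.exp_conj, map_neg, map_mul, map_mul, Complex.conj_ofReal,
      Complex.conj_I, map_natCast]
    congr 1
    ring
  rw [hf, eval_eq_sum_range' (lt_of_le_of_lt hp (Nat.lt_succ_self _)), star_mul', star_sum,
    eval_finsetSum, Finset.sum_mul, Finset.sum_mul]
  refine Finset.sum_congr rfl fun k hk => ?_
  have hk' : k ≤ 2 * N := by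
    have := Finset.mem_range_succ_iff.1 hk
    omega
  have key : cexp (-(θ * I)) ^ k * cexp (N * θ * I) =
      cexp (θ * I) ^ (2 * N - k) * cexp (-(N * θ * I)) := by
    rw [← Complex.exp_nat_mul, ← Complex.exp_nat_mul, ← Complex.exp_add, ← Complex.exp_add]
    congr 1
    push_cast [Nat.cast_sub hk']
    ring
  rw [star_mul', star_pow, eval_mul, eval_C, eval_pow, eval_X, hz, hE, mul_assoc, key, ← mul_assoc]

/-- **Leibniz with row degrees.** If row `i` of `M(θ)` has entries in `T(d i)`, then
`det M(θ) ∈ T(∑ i, d i)` (`det M = ∑_σ sgn σ ∏_i M_{σ i, i}` and `∑_i d (σ i) = ∑_i d i`). [folklore] -/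
theorem tp_det {n : Type*} [Fintype n] [DecidableEq n] (M : ℝ → Matrix n n ℂ) (d : n → ℕ)
    (hM : ∀ i j, ∃ p : ℂ[X], p.natDegree ≤ 2 * d i ∧ ∀ θ : ℝ,
      M θ i j = p.eval (cexp (θ * I)) * cexp (-(d i * θ * I))) :
    ∃ p : ℂ[X], p.natDegree ≤ 2 * (∑ i, d i) ∧ ∀ θ : ℝ,
      (M θ).det = p.eval (cexp (θ * I)) * cexp (-((∑ i, d i : ℕ) * θ * I)) := by
  simp_rw [Matrix.det_apply']
  refine tp_sum _ _ fun σ _ => tp_const_mul _ ?_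
  have h := tp_prod Finset.univ (fun i => d (σ i)) (fun i θ => M θ (σ i) i) fun i _ => hM (σ i) i
  have hσ : ∑ i, d (σ i) = ∑ i, d i := Equiv.sum_comp σ d
  rw [hσ] at h
  exact h

/-! ### The Wilson–Dirac matrix with one link moving along a curve -/

/-- The colour group `SU(3)` (local shorthand). -/
local notation "SU3" => Matrix.specialUnitaryGroup (Fin 3) ℂ

variable {L : ℕ}

/-- Entries of the link variables of `U` with the link `e` replaced by `κ(θ)`: in `T(1)` for the link
`e` itself (hypothesis on `κ`), constants (`T(0)`) for every other link. [folklore] -/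
theorem tp_link (U : GaugeConfig 4 L SU3) (e e' : Edge 4 L) (κ : ℝ → SU3)
    (hκ : ∀ a b : Fin 3, ∃ p : ℂ[X], p.natDegree ≤ 2 * 1 ∧ ∀ θ : ℝ,
      (κ θ : Matrix (Fin 3) (Fin 3) ℂ) a b = p.eval (cexp (θ * I)) * cexp (-((1 : ℕ) * θ * I)))
    (a b : Fin 3) :
    ∃ p : ℂ[X], p.natDegree ≤ 2 * (if e' = e then 1 else 0) ∧ ∀ θ : ℝ,
      ((Function.update U e (κ θ) e' : SU3) : Matrix (Fin 3) (Fin 3) ℂ) a b =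
        p.eval (cexp (θ * I)) * cexp (-((if e' = e then 1 else 0 : ℕ) * θ * I)) := by
  by_cases he : e' = e
  · subst he
    simp only [Function.update_self, if_true]
    exact hκ a b
  · simp only [Function.update_of_ne he, if_neg he]
    exact tp_const 0 _

/-- Entries of the `r`-Wilson–Dirac matrix of `U` with the link `e` replaced by `κ(θ)`: row
`p = (x, a, α)` has entries in `T(d p)`, `d p = [x = e.1] + [x = e.1 + ê.2]` — by the tree definition
`wilsonDirac`, the entry `(p, q)` is a constant minus `½ ∑_μ` of a forward hop through the link
`(x, μ)` (moving only if `(x, μ) = e`) and a backward hop through the inverse (= conjugate transpose in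
`SU(3)`) of the link `(y, μ)` with `x = y + μ̂` (moving only if `(y, μ) = e`, whence `x = e.1 + ê.2`).
[folklore] -/
theorem tp_wilsonDirac_apply [NeZero L] (U : GaugeConfig 4 L SU3) (e : Edge 4 L) (κ : ℝ → SU3)
    (hκ : ∀ a b : Fin 3, ∃ p : ℂ[X], p.natDegree ≤ 2 * 1 ∧ ∀ θ : ℝ,
      (κ θ : Matrix (Fin 3) (Fin 3) ℂ) a b = p.eval (cexp (θ * I)) * cexp (-((1 : ℕ) * θ * I)))
    (m r : ℝ) (p q : TorusSite 4 L × Fin 3 × Fin 4) :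
    ∃ P : ℂ[X], P.natDegree ≤ 2 * ((fun p : TorusSite 4 L × Fin 3 × Fin 4 =>
        (if p.1 = e.1 then 1 else 0) + (if p.1 = e.1.shift e.2 then 1 else 0)) p) ∧ ∀ θ : ℝ,
      wilsonDirac (fundamentalRep (Fin 3)) (Function.update U e (κ θ)) m r p q =
        P.eval (cexp (θ * I)) * cexp (-(((fun p : TorusSite 4 L × Fin 3 × Fin 4 =>
          (if p.1 = e.1 then 1 else 0) + (if p.1 = e.1.shift e.2 then 1 else 0)) p : ℕ) * θ * I)) := by
  simp only [wilsonDirac, Matrix.of_apply, fundamentalRep_apply]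
  refine tp_sub (tp_const _ _) (tp_const_mul _ (tp_sum _ _ fun μ _ => tp_add ?_ ?_))
  · -- forward hop through the link `(p.1, μ)`
    refine tp_ite _ (tp_const_mul _ (tp_mono ?_ (tp_link U e (p.1, μ) κ hκ _ _))) (tp_const _ _)
    by_cases h : (p.1, μ) = e
    · rw [if_pos h, if_pos (by rw [← h])]
      exact Nat.le_add_right _ _
    · rw [if_neg h]
      exact Nat.zero_le _
  · -- backward hop through the inverse of the link `(q.1, μ)`
    by_cases hc : p.1 = Site.shift q.1 μ
    · simp only [if_pos hc]
      refine tp_const_mul _ ?_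
      have hstar : ∀ θ : ℝ, (((Function.update U e (κ θ) (q.1, μ))⁻¹ : SU3) :
          Matrix (Fin 3) (Fin 3) ℂ) p.2.1 q.2.1 =
          star (((Function.update U e (κ θ) (q.1, μ) : SU3) : Matrix (Fin 3) (Fin 3) ℂ) q.2.1 p.2.1) :=
        fun θ => rfl
      simp_rw [hstar]
      refine tp_mono ?_ (tp_star (tp_link U e (q.1, μ) κ hκ _ _))
      by_cases h : (q.1, μ) = e
      · rw [if_pos h, if_pos (show p.1 = e.1.shift e.2 by rw [← h]; exact hc)]
        exact Nat.le_add_left _ _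
      · rw [if_neg h]
        exact Nat.zero_le _
    · simp only [if_neg hc]
      exact tp_const _ _

/-- The total row degree is `24`: twelve rows at the site `e.1` and twelve at `e.1 + ê.2` (colour
`× ` spin `= 3 × 4`). [folklore] -/
theorem sum_rowDegree [NeZero L] (e : Edge 4 L) :
    ∑ p : TorusSite 4 L × Fin 3 × Fin 4, (fun p : TorusSite 4 L × Fin 3 × Fin 4 =>
      (if p.1 = e.1 then 1 else 0) + (if p.1 = e.1.shift e.2 then 1 else 0)) p = 24 := by
  have h : ∀ x : TorusSite 4 L,
      ∑ p : TorusSite 4 L × Fin 3 × Fin 4, (if p.1 = x then 1 else 0) = 12 := by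
    intro x
    calc ∑ p : TorusSite 4 L × Fin 3 × Fin 4, (if p.1 = x then 1 else 0)
        = ∑ a : TorusSite 4 L, ∑ _b : Fin 3 × Fin 4, (if a = x then 1 else 0) :=
          Fintype.sum_prod_type _
      _ = ∑ a : TorusSite 4 L, (if a = x then 12 else 0) := by
          refine Finset.sum_congr rfl fun a _ => ?_
          split_ifs <;> simp
      _ = 12 := by simp
  simp only [Finset.sum_add_distrib, h]

/-- Two-sided products with constant matrices preserve the entry class `T(N)`:
`(A M(θ) B)_{ab} = ∑_j (∑_i A_{ai} M(θ)_{ij}) B_{jb}`. [folklore] -/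
theorem tp_matrix_mul_mul {N : ℕ} (A B : Matrix (Fin 3) (Fin 3) ℂ) (M : ℝ → Matrix (Fin 3) (Fin 3) ℂ)
    (hM : ∀ i j : Fin 3, ∃ p : ℂ[X], p.natDegree ≤ 2 * N ∧ ∀ θ : ℝ,
      M θ i j = p.eval (cexp (θ * I)) * cexp (-(N * θ * I))) (a b : Fin 3) :
    ∃ p : ℂ[X], p.natDegree ≤ 2 * N ∧ ∀ θ : ℝ,
      (A * M θ * B) a b = p.eval (cexp (θ * I)) * cexp (-(N * θ * I)) := by
  simp only [Matrix.mul_apply]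
  exact tp_sum _ _ fun j _ => tp_mul_const _ (tp_sum _ _ fun i _ => tp_const_mul _ (hM i j))

/-- **The Wilson determinant along a translated one-link letter is a trigonometric polynomial of
degree `≤ 24`.**  If the curve `c : ℝ → SU(3)` has matrix `M_c(θ)` with entries of the form
`p(e^{iθ}) e^{-iθ}`, `deg p ≤ 2` (i.e. `α e^{iθ} + β + γ e^{-iθ}`), then for every volume, configuration
`U`, parameters `m, r`, edge `e` and `g, h ∈ SU(3)` there is `P ∈ ℂ[X]` with `deg P ≤ 48` and
`‖det D_W(U[e ↦ g c(θ) h]; m, r)‖ = ‖P(e^{iθ})‖` for all `θ` — uniformly in the volume (Leibniz with row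
degrees: `tp_det`, `tp_wilsonDirac_apply`, `sum_rowDegree`; the entries of `g M_c(θ) h` are again of
degree `≤ 1`, `tp_matrix_mul_mul`). [folklore] -/
theorem exists_poly_norm_det_wilsonDirac_update [NeZero L] (U : GaugeConfig 4 L SU3) (m r : ℝ)
    (e : Edge 4 L) (g h : SU3) (c : ℝ → SU3) (Mc : ℝ → Matrix (Fin 3) (Fin 3) ℂ)
    (hc : ∀ θ : ℝ, (c θ : Matrix (Fin 3) (Fin 3) ℂ) = Mc θ)
    (hM : ∀ a b : Fin 3, ∃ p : ℂ[X], p.natDegree ≤ 2 * 1 ∧ ∀ θ : ℝ,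
      Mc θ a b = p.eval (cexp (θ * I)) * cexp (-((1 : ℕ) * θ * I))) :
    ∃ P : ℂ[X], P.natDegree ≤ 48 ∧ ∀ θ : ℝ,
      ‖(wilsonDirac (fundamentalRep (Fin 3)) (Function.update U e (g * c θ * h)) m r).det‖ =
        ‖P.eval (cexp (θ * I))‖ := by
  set κ : ℝ → SU3 := fun θ => g * c θ * h with hκdef
  have hκ : ∀ a b : Fin 3, ∃ p : ℂ[X], p.natDegree ≤ 2 * 1 ∧ ∀ θ : ℝ,
      (κ θ : Matrix (Fin 3) (Fin 3) ℂ) a b = p.eval (cexp (θ * I)) * cexp (-((1 : ℕ) * θ * I)) := by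
    intro a b
    obtain ⟨p, hp, hh⟩ := tp_matrix_mul_mul (g : Matrix (Fin 3) (Fin 3) ℂ) (h : Matrix (Fin 3) (Fin 3) ℂ)
      Mc hM a b
    refine ⟨p, hp, fun θ => ?_⟩
    rw [← hh θ, ← hc θ]
    simp only [hκdef, Submonoid.coe_mul]
  obtain ⟨P, hP, hPθ⟩ := tp_det (fun θ => wilsonDirac (fundamentalRep (Fin 3)) (Function.update U e (κ θ)) m r)
    (fun p : TorusSite 4 L × Fin 3 × Fin 4 =>
      (if p.1 = e.1 then 1 else 0) + (if p.1 = e.1.shift e.2 then 1 else 0))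
    fun p q => tp_wilsonDirac_apply U e κ hκ m r p q
  rw [sum_rowDegree e] at hP hPθ
  refine ⟨P, hP, fun θ => ?_⟩
  rw [hPθ θ, norm_mul, Complex.norm_exp]
  simp

end Summit.QuantumFields.QCD.Theorems.SingleLinkLogFlatness

end
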